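import Summits.AtomisticToContinuum.Crystallization.Theses.GrandCanonicalSelection
import Literature.MathematicalPhysics.StatisticalMechanics.BarlowStacking

/-!
# Birth skeleton (BC3) — crux `GrandCanonicalSelection.SolidMuGSCCrystalline`

Item `stmt-AtomisticToContinuum-13681` (crux, rank 2 of `route-AtomisticToContinuum-GrandCanonicalSelection`,
sub-problem `Crystallization`; wanted by this route only). Published as
`Cruxes/SolidMuGSCCrystalline/Lines/birth.lean`.

The crux (BULK POSITIONAL ORDER FOR μ-STABLE SOLID LENNARD-JONES MATTER AT COEXISTENCE): for
`e = lim E(N)/N` and every `r₁ > 0` there are finitely many periodic configurations `P₁ … P_m` of `ℝ³`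
such that for all `R, δ > 0` there is `R'` with: every uniformly discrete `μ`GSC `X` of Lennard-Jones at
`μ = e` (`IsMuGSC lennardJones e X`: no finite modification lowers `U − e·#`) that `r₁`-covers some ball
of radius `R'` is two-way `δ`-matched (`Match δ R c X (g '' (P l).points)`) on some ball of radius `R`
to a rigid image of some `P_l`.

## The line — the route header's own TWO-LAYER PLAN, typed over `μ`GSCs
("SolidMuGSCCrystalline ⇐ LocalOrderFromMuStability → StackingPropagation"), with the seam placed at
BARLOW WINDOWS — two-way `ε`-matching on a ball of radius `R₁` to a rigid image of SOME relaxed Barlow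
stacking `barlowStacking a h s` (`a, h ∈ (1/2, 2)`, `s` any Hägg sequence; tree definitions of
`BarlowStacking.lean` / `HaggStacking.lean`), the `μ`GSC analogue of the finite-`N` window predicate of
items stmt-AtomisticToContinuum-14292 (`LaminarBarlowWindows`) / 0759 and of the registered skeleton
`Cruxes/BrittleBarlowRigidity/Lines/birth.lean`:

* `stub_barlowWindowsOfSolid` (S1 — BARLOW-ISATION OF SOLID μ-STABLE MATTER, size XL, load-bearing):
  solid `μ`-stable Lennard-Jones matter at coexistence contains, at every scale `R₁` and accuracy `ε`,
  a Barlow window. Content: local close-packed order from the one-particle removal / insertion tests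
  (Kossel pointwise bounds: no atom bound by less than `|e|`, no empty site binding by more), layer
  propagation from fcc/hcp shells (Hales, *Dense Sphere Packings* §1.3; tree `HalesDSP_layerPackings_holds`),
  and VANISHING STRAIN from `μ`-stability at coexistence (a homogeneously strained or mis-scaled region of
  radius `r` carries excess energy `∝ r³` against an interface `∝ r²`, so only strains `O(r^{-1/2})`
  survive and windows of radius `R₁ ≪ r^{1/2}` are `ε`-exact). The seam tolerates every Hägg word `s`
  (stacking faults parallel to the layers are NOT defects here) and relaxed parameters `(a, h)` (the
  Lennard-Jones hcp minimiser is not ideal: `h*/a* ≠ √(2/3)` at the `10⁻⁴` level, which is why the seam is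
  not "shells `η`-close to the ideal kissing patterns for every `η`").
* `stub_stackingSelection` (S2 — STACKING AND SCALE SELECTION AT COEXISTENCE, size L/XL, carries the
  crux's declared risk): for `e = lim E(N)/N` there is ONE finite family `P₁ … P_m` such that a `μ`GSC at
  `μ = e` with a sufficiently exact and large Barlow window is `δ`-matched on a ball of radius `R` to a
  rigid image of some `P_l`. Content: at coexistence bulk terms cancel, so inside the window a Hägg word
  with excess energy density `Δ > 0` over the optimal word, or parameters `(a, h)` off the minimisers, is
  removed on balls of radius `> C/Δ` (volume against interface); Hägg domination for the relaxed
  Lennard-Jones couplings (landed for the registry box: `GscLoopSurgery.LjRegistryDomination`, item 3063,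
  and `HaggDominationAllRanges`, item 0737) makes every non-hcp layer triple cost `≥ |J₂| − Σ_{k≥3} k|J_k| > 0`
  per unit area, so faults are sparse and some sub-ball of radius `R` is fault-free and parameter-pinned.
  A consequence of the crux on paper (a Barlow window with `a, h < 2` is `2`-solid), hence strictly weaker.
* Composition `SolidMuGSCCrystalline_of : Goal.stub_barlowWindowsOfSolid → Goal.stub_stackingSelection →
  crux` (REAL proof, pure logic: the family from S2; given `(R, δ)` S2 yields `(ε, R₁)`, S1 at
  `(r₁, ε, R₁)` yields `R'`; a solid `X` gets a Barlow window from S1 and a matched `P_l`-window from S2),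
  and `SolidMuGSCCrystalline_skeleton : crux` — the crux BY NAME from the two registered stubs (the only
  `sorry`s in its cone).

Layout as in the registered skeletons `Cruxes/BrittleBarlowRigidity/Lines/birth.lean` and
`Cruxes/BulkDefectVanishBased/Lines/birth.lean`: §0 the stub STATEMENTS as `Goal.stub_*` (character for
character the §1 signatures; the composition takes them by name), §1 the registered stubs
`theorem stub_* : <inlined signature> := by sorry`, §2 the composition and the by-name skeleton theorem.

Disproof used: none on file (no `Cruxes/SolidMuGSCCrystalline/` workfiles before this skeleton: no
`Disproof.lean`, no `Negative/` lemmas, no ideas, no dead lines; 2026-08-17). Negatives index: neither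
stub is an instance of a refuted statement of the summit — both are statements about infinite `μ`-stable
configurations (`IsMuGSC`), over uniformly discrete sets, with ONE finite family quantified before
`(R, δ)` in S2 (not a `∀ P` one-grain gluing, not a twelve-shell census or classification claim, no
multiplicity-blind counting).
-/

namespace Summit.AtomisticToContinuum.Crystallization.Cruxes.SolidMuGSCCrystalline.Birth

/-! ## §0 The two stub STATEMENTS as named propositions (namespace `Goal`; each is, character for
character, the signature of the registered stub of the same short name in §1) -/

namespace Goal

/-- Statement of S1 `stub_barlowWindowsOfSolid` (see §1). -/
def stub_barlowWindowsOfSolid : Prop :=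
  ∀ e : ℝ, Filter.Tendsto (fun N : ℕ => Literature.MathematicalPhysics.StatisticalMechanics.groundStateEnergy Literature.MathematicalPhysics.StatisticalMechanics.lennardJones 3 N / N) Filter.atTop (nhds e) → ∀ r₁ : ℝ, 0 < r₁ → ∀ ε : ℝ, 0 < ε → ∀ R₁ : ℝ, 0 < R₁ → ∃ R' : ℝ, ∀ X : Set (EuclideanSpace ℝ (Fin 3)), Literature.MathematicalPhysics.StatisticalMechanics.UniformlyDiscrete X → Literature.MathematicalPhysics.StatisticalMechanics.IsMuGSC Literature.MathematicalPhysics.StatisticalMechanics.lennardJones e X → (∃ c : EuclideanSpace ℝ (Fin 3), ∀ z : EuclideanSpace ℝ (Fin 3), dist z c ≤ R' → ∃ x ∈ X, dist x z ≤ r₁) → ∃ (a h : ℝ) (s : ℤ → ℤ) (g : EuclideanSpace ℝ (Fin 3) ≃ᵃⁱ[ℝ] EuclideanSpace ℝ (Fin 3)) (c : EuclideanSpace ℝ (Fin 3)), 1 / 2 < a ∧ a < 2 ∧ 1 / 2 < h ∧ h < 2 ∧ Literature.MathematicalPhysics.StatisticalMechanics.IsHaggSeq s ∧ Literature.MathematicalPhysics.StatisticalMechanics.Match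 ε R₁ c X (g '' Literature.MathematicalPhysics.StatisticalMechanics.barlowStacking a h s)

/-- Statement of S2 `stub_stackingSelection` (see §1). -/
def stub_stackingSelection : Prop :=
  ∀ e : ℝ, Filter.Tendsto (fun N : ℕ => Literature.MathematicalPhysics.StatisticalMechanics.groundStateEnergy Literature.MathematicalPhysics.StatisticalMechanics.lennardJones 3 N / N) Filter.atTop (nhds e) → ∃ (m : ℕ) (P : Fin m → Literature.MathematicalPhysics.StatisticalMechanics.PeriodicConfiguration 3), ∀ R δ : ℝ, 0 < R → 0 < δ → ∃ ε R₁ : ℝ, 0 < ε ∧ 0 < R₁ ∧ ∀ X : Set (EuclideanSpace ℝ (Fin 3)), Literature.MathematicalPhysics.StatisticalMechanics.UniformlyDiscrete X → Literature.MathematicalPhysics.StatisticalMechanics.IsMuGSC Literature.MathematicalPhysics.StatisticalMechanics.lennardJones e X → (∃ (a h : ℝ) (s : ℤ → ℤ) (g : EuclideanSpace ℝ (Fin 3) ≃ᵃⁱ[ℝ] EuclideanSpace ℝ (Fin 3)) (c : EuclideanSpace ℝ (Fin 3)), 1 / 2 < a ∧ a < 2 ∧ 1 / 2 < h ∧ h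 < 2 ∧ Literature.MathematicalPhysics.StatisticalMechanics.IsHaggSeq s ∧ Literature.MathematicalPhysics.StatisticalMechanics.Match ε R₁ c X (g '' Literature.MathematicalPhysics.StatisticalMechanics.barlowStacking a h s)) → ∃ (l : Fin m) (g : EuclideanSpace ℝ (Fin 3) ≃ᵃⁱ[ℝ] EuclideanSpace ℝ (Fin 3)) (c : EuclideanSpace ℝ (Fin 3)), Literature.MathematicalPhysics.StatisticalMechanics.Match δ R c X (g '' (P l).points)

end Goal

/-! ## §1 Registered stubs (the ONLY `sorry`s of the file; signatures fully inlined and qualified) -/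

/-- **S1 — Barlow-isation of solid `μ`-stable matter (size XL, load-bearing).** For `e = lim E(N)/N`
(the coexistence chemical potential `μ = e* = inf_N E(N)/N`), every covering radius `r₁ > 0`, every
accuracy `ε > 0` and every window radius `R₁ > 0` there is a solidity radius `R'` such that every uniformly
discrete `μ`GSC `X` of Lennard-Jones at `μ = e` which `r₁`-covers some ball of radius `R'` is, on SOME
ball of radius `R₁` (anywhere), two-way `ε`-matched to a rigid image `g '' barlowStacking a h s` of some
relaxed Barlow stacking (`1/2 < a, h < 2`, `s` a Hägg sequence).
Why plausibly true: in a `μ`-stable region at `μ = e*` the one-particle tests are two-sided Kossel bounds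
(every atom binds by `≥ |e*|`, every empty site by `≤ |e*|`; tree `IsMuGSC.removal/insertion`), which
exclude vacancies, interstitials and — with finite cluster tests — under/over-coordinated pockets, leaving
twelve-coordinated close-packed local order (fcc/hcp shells; the only two tangent patterns compatible with
kissing-twelve everywhere, Hales 2012 Thm 1, tree `Hales2012_kissingTwelve`); fcc/hcp shells propagate to
hexagonal layers, i.e. to a Barlow stacking combinatorially (HalesDSP2012 §1.3, DISCHARGED in tree as
`HalesDSP_layerPackings_holds`); and at coexistence bulk terms cancel (`ΔΩ = σ·ΔArea`), so elastic strain,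
dislocation content and grain-boundary area inside a ball of radius `r` are `O(r²)` in energy, forcing
strain `O(r^{-1/2})` and a defect-free, `ε`-exact window of radius `R₁` somewhere inside once
`r ≫ R₁²/ε²` (Friesecke–James–Müller rigidity on the tetrahedron–octahedron truss). Every Hägg word is
admissible (parallel stacking faults are not defects of the seam) and `(a, h)` are free in `(1/2, 2)`
(the relaxed LJ hcp minimiser has `a* ≈ 0.971`, `h* ≈ 0.793 ≠ a*√(2/3)` exactly).
Why it might fail: this is bulk positional order for Lennard-Jones under the sharpest free hypotheses —
false iff some solid `μ`-stable configuration at `μ = e*` is nowhere Barlow at one scale: frustrated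
icosahedral / Frank–Kasper order surviving every finite insertion–removal test
(`Literature.Barriers.AtomisticToContinuum.TetrahedralFrustration`, `…KissingTwelveDegeneracy`,
`…FlexibleKissingArrangements`), or long-range elastic fields of `μ`-stable defect networks spoiling
`ε`-exactness at every location.
Sources: Suto2006 §2 (μGSC), BlancLewin2015 §2.3, Hales2012 (arXiv:1209.6043) Thm 1, HalesDSP2012 §1.3,
FlatleyTheil2015 (arXiv:1407.0692) Thm 3.5 / Prop 3.3, FrieseckeJamesMuller2002, Theil2006,
doi:10.1098/rsta.1951.0006 §1–2 (Kossel–Stranski kink rule). Leans on: `IsMuGSC.removal`,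
`IsMuGSC.insertion`, `UniformlyDiscrete.summable_lennardJones` (`MuGSC.lean`), `barlowStacking`,
`le_dist_of_mem_barlowStacking` (`BarlowStacking.lean`), `HalesDSP_layerPackings_holds`,
`KissingRigidity.lean`; sibling items `LaminarKissing.LaminarBarlowWindows` (14292, finite `N`),
`CrystalKissingRigidity.RobustFejesTothHales` (0758, moot), route support `KosselPointwise` (13688). -/
theorem stub_barlowWindowsOfSolid :
    ∀ e : ℝ, Filter.Tendsto (fun N : ℕ => Literature.MathematicalPhysics.StatisticalMechanics.groundStateEnergy Literature.MathematicalPhysics.StatisticalMechanics.lennardJones 3 N / N) Filter.atTop (nhds e) → ∀ r₁ : ℝ, 0 < r₁ → ∀ ε : ℝ, 0 < ε → ∀ R₁ : ℝ, 0 < R₁ → ∃ R' : ℝ, ∀ X : Set (EuclideanSpace ℝ (Fin 3)), Literature.MathematicalPhysics.StatisticalMechanics.UniformlyDiscrete X → Literature.MathematicalPhysics.StatisticalMechanics.IsMuGSC Literature.MathematicalPhysics.StatisticalMechanics.lennardJones e X → (∃ c : EuclideanSpace ℝ (Fin 3), ∀ z : EuclideanSpace ℝ (Fin 3), dist z c ≤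 R' → ∃ x ∈ X, dist x z ≤ r₁) → ∃ (a h : ℝ) (s : ℤ → ℤ) (g : EuclideanSpace ℝ (Fin 3) ≃ᵃⁱ[ℝ] EuclideanSpace ℝ (Fin 3)) (c : EuclideanSpace ℝ (Fin 3)), 1 / 2 < a ∧ a < 2 ∧ 1 / 2 < h ∧ h < 2 ∧ Literature.MathematicalPhysics.StatisticalMechanics.IsHaggSeq s ∧ Literature.MathematicalPhysics.StatisticalMechanics.Match ε R₁ c X (g '' Literature.MathematicalPhysics.StatisticalMechanics.barlowStacking a h s) := by
  sorry

/-- **S2 — Stacking and scale selection at coexistence (size L/XL; carries the crux's declared risk).**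
For `e = lim E(N)/N` there are finitely many periodic configurations `P₁ … P_m` of `ℝ³` (intended: the
relaxed hcp minimiser `hcpPeriodicConfiguration a* h*` and any EXACTLY degenerate optimal polytypes, in
the finitely many orientations/re-basings a matched window needs — `g` ranges over all rigid motions, so
one representative per polytype suffices) such that for all `R, δ > 0` there are an accuracy `ε > 0` and a
window radius `R₁ > 0` with: every uniformly discrete `μ`GSC `X` of Lennard-Jones at `μ = e` that is
two-way `ε`-matched on some ball of radius `R₁` to a rigid image of some relaxed Barlow stacking
`barlowStacking a h s` (`1/2 < a, h < 2`, `IsHaggSeq s`) is two-way `δ`-matched on some ball of radius `R`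
to a rigid image of some `P_l`.
Why plausibly true: on paper a CONSEQUENCE of the crux (a Barlow window with `a, h < 2` is `2`-solid on a
ball of radius `R₁ − 3`, so the crux at `r₁ = 2` applies) — hence strictly weaker; directly: at `μ = e*`
the removal test on a ball of radius `r` inside the window reads `n_W e(a, h, s|_W) + O(r²) ≤ e* n_W`,
so the window's Hägg word and parameters are optimal up to `O(1/r)` in energy density; Hägg domination
for the relaxed Lennard-Jones couplings (`|J₂| ≥ 2 Σ_{k≥3} (k−1)|J_k|`, PROVED on the registry box as
`GscLoopSurgery.LjRegistryDomination`, item 3063; finite-volume count `HaggDominationAllRanges`, item 0737,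
PROVED) prices every non-hcp layer triple at `≥ |J₂| − Σ_{k≥3} k|J_k| > 0` per unit area, so fault planes
in a ball of radius `r` have total area `O(r²)` and most sub-balls of radius `R` are fault-free; strict
minimality of `(a*, h*)` for `e_hcp(a, h)` (box minimiser landed: `HcpEnergyMinOnBox`, item 3066) pins
`(a, h)` to `O(r^{-1/2})`, below `δ/R` once `R₁ ≥ r ≫ R²/δ²`.
Why it might fail: exactly the crux's declared risk — if Hägg domination fails off the registry box or the
optimal Hägg word is aperiodic (ANNNI-type frustration from `J₃, J₄, …`;
`Literature.Barriers.AtomisticToContinuum.Hubbard1978_mostHomogeneous`), or if infinitely many polytypes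
are EXACTLY degenerate with hcp (`e_fcc = e_hcp = …`), no finite family serves all `(R, δ)`; a continuum
of degenerate `(a, h)` minimisers would break it the same way.
Sources: BlancLewin2015 §2.3, PartayOrtnerCsanyi2017 (arXiv:1705.01751) p. 4, Stillinger2001,
LoachAckland2017, Suto2006 §2, stmt-AtomisticToContinuum-3063/0737/3066,
Literature.Barriers.AtomisticToContinuum.ShortRangeStackingBlindness (selection needs the tail beyond
`√(8/3)`). Leans on: `barlowCoupling`, `haggEnergy`, `haggLocalEnergy_periodic` (`HaggStacking.lean`,
`BarlowStackingEnergy.lean`), `hcpPeriodicConfiguration`, `barlowPeriodicConfiguration_points`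
(`BarlowStacking.lean`), `BarlowStackingWindowRebase.lean`, `Match.mono/symm` (`MuGSC.lean`),
`PeriodicConfiguration.hasSum_lennardJones_dist_three`; route support `PinnedPeriodicAttains` (13687) is
the same removal-test bookkeeping. -/
theorem stub_stackingSelection :
    ∀ e : ℝ, Filter.Tendsto (fun N : ℕ => Literature.MathematicalPhysics.StatisticalMechanics.groundStateEnergy Literature.MathematicalPhysics.StatisticalMechanics.lennardJones 3 N / N) Filter.atTop (nhds e) → ∃ (m : ℕ) (P : Fin m → Literature.MathematicalPhysics.StatisticalMechanics.PeriodicConfiguration 3), ∀ R δ : ℝ, 0 < R → 0 < δ → ∃ ε R₁ : ℝ, 0 < ε ∧ 0 < R₁ ∧ ∀ X : Set (EuclideanSpace ℝ (Fin 3)), Literature.MathematicalPhysics.StatisticalMechanics.UniformlyDiscrete X → Literature.MathematicalPhysics.StatisticalMechanics.IsMuGSC Literature.MathematicalPhysics.StatisticalMechanics.lennardJones e X → (∃ (a h : ℝ) (s : ℤ → ℤ) (g : EuclideanSpace ℝ (Fin 3) ≃ᵃⁱ[ℝ] EuclideanSpace ℝ (Fin 3)) (c : EuclideanSpace ℝ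 (Fin 3)), 1 / 2 < a ∧ a < 2 ∧ 1 / 2 < h ∧ h < 2 ∧ Literature.MathematicalPhysics.StatisticalMechanics.IsHaggSeq s ∧ Literature.MathematicalPhysics.StatisticalMechanics.Match ε R₁ c X (g '' Literature.MathematicalPhysics.StatisticalMechanics.barlowStacking a h s)) → ∃ (l : Fin m) (g : EuclideanSpace ℝ (Fin 3) ≃ᵃⁱ[ℝ] EuclideanSpace ℝ (Fin 3)) (c : EuclideanSpace ℝ (Fin 3)), Literature.MathematicalPhysics.StatisticalMechanics.Match δ R c X (g '' (P l).points) := by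
  sorry

/-! ## §2 Composition (kernel-checked, no `sorry`): the stub statements imply the crux BY NAME -/

/-- **Composition: S1 → S2 → `SolidMuGSCCrystalline`** (hypotheses = the §0 statements by name,
definitionally the §1 signatures). Pure logic: given `e` with `E(N)/N → e` and `r₁ > 0`, S2 supplies the
finite family `(m, P)`; given `(R, δ)`, S2 supplies `(ε, R₁)` and S1 (at `r₁, ε, R₁`) supplies `R'`; a
uniformly discrete `μ`GSC that is `r₁`-solid on a ball of radius `R'` has a Barlow window of radius `R₁` at
accuracy `ε` (S1), hence a `δ`-matched `P_l`-window of radius `R` (S2). -/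
theorem SolidMuGSCCrystalline_of :
    Goal.stub_barlowWindowsOfSolid → Goal.stub_stackingSelection →
    Summit.AtomisticToContinuum.Crystallization.Theses.GrandCanonicalSelection.SolidMuGSCCrystalline := by
  intro hS1 hS2
  unfold Goal.stub_barlowWindowsOfSolid at hS1
  unfold Goal.stub_stackingSelection at hS2
  unfold Summit.AtomisticToContinuum.Crystallization.Theses.GrandCanonicalSelection.SolidMuGSCCrystalline
  intro e he r₁ hr₁
  -- S2: the finite family of periodic patterns at the coexistence potential `e`
  obtain ⟨m, P, hP⟩ := hS2 e he
  refine ⟨m, P, fun R δ hR hδ => ?_⟩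
  -- S2 at `(R, δ)`: the accuracy and radius a Barlow window must have
  obtain ⟨ε, R₁, hε, hR₁, hsel⟩ := hP R δ hR hδ
  -- S1 at `(r₁, ε, R₁)`: the solidity radius that guarantees such a window
  obtain ⟨R', hwin⟩ := hS1 e he r₁ hr₁ ε hε R₁ hR₁
  exact ⟨R', fun X hUD hGSC hsolid => hsel X hUD hGSC (hwin X hUD hGSC hsolid)⟩

/-- **The registered skeleton in one line**: the two §1 stubs fed into `SolidMuGSCCrystalline_of` prove
the crux by name (`#print axioms` reaches `sorryAx` exactly through the two stubs). -/
theorem SolidMuGSCCrystalline_skeleton :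
    Summit.AtomisticToContinuum.Crystallization.Theses.GrandCanonicalSelection.SolidMuGSCCrystalline :=
  SolidMuGSCCrystalline_of stub_barlowWindowsOfSolid stub_stackingSelection

/-- The registered stub signatures are, definitionally, the `Goal` statements. -/
example : Goal.stub_barlowWindowsOfSolid ∧ Goal.stub_stackingSelection :=
  ⟨stub_barlowWindowsOfSolid, stub_stackingSelection⟩

end Summit.AtomisticToContinuum.Crystallization.Cruxes.SolidMuGSCCrystalline.Birth
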